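/-
Copyright (c) 2026. All rights reserved.
Released under Apache 2.0 license as described in the file LICENSE.
-/
import Literature.AlgebraicGeometry.Pohlmann1968.CMTypeRankStabilizerBound
import Literature.NumberTheory.ComplexMultiplication.CMTypeInducedFromPrimitive
import HarnessLib

/-!
# Any CM field: all Hodge classes on all powers are divisorial iff `2·(Rank(Φ) − 1)` is the degree of the primitive
# core

SETTING.  `K` ANY CM field (no Galois hypothesis), `Φ` a CM type of `K`, `A` any abelian variety of type `(K; Φ)`.
By Streng's Lemma I.3.5 / Shimura §8.2 Prop. 26 (tree `exists_primitive_inducedCMType_eq_of_isCMField`) `Φ` is induced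
from a PRIMITIVE type `Φ₁` of a smallest CM subfield `K₁ ⊆ K` — the primitive core, unique as the minimum of the
inducing sub-pairs.  Hazama's criterion (B. B. Gordon [Gordon1999HodgeAVSurvey] Thm. 6.4; tree
`isNondegenerate_iff_forall_pow_hodgeClassSpan_eq_inducedCMType`) and the invariance of the rank under induction
(Shimura §32.9; tree `cmTypeRank_inducedCMType`) give a criterion by two integers, `Rank(Φ)` and `[K₁:ℚ]`:

> **Theorem** (`forall_pow_hodgeClassSpan_eq_iff_exists_two_mul_cmTypeRank_sub_one_eq`).  For every CM field `K`,
> CM type `Φ`, abelian variety `A` of type `(K; Φ)`:  `Bᵐ(Aⁿ) ⊗ ℂ = Dᵐ(Aⁿ) ⊗ ℂ` for all `n, m` iff `Φ` is induced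
> from a CM type of a CM subfield `k ⊆ K` with **`[k:ℚ] = 2·(Rank(Φ) − 1)`** (for every inducing subfield
> `[k:ℚ] ≥ 2·(Rank(Φ) − 1)`, `two_mul_cmTypeRank_sub_one_le_finrank_of_inducedCMType`); for the primitive core
> `(K₁, Φ₁)` this reads `[K₁:ℚ] = 2·(Rank(Φ) − 1)` (`forall_pow_hodgeClassSpan_eq_iff_of_minimal`), and if EVERY
> inducing subfield has `[k:ℚ] > 2·(Rank(Φ) − 1)` then some power of `A` carries an exceptional Hodge class
> (`exists_exceptional_pow_of_forall_inducedCMType_lt`); in any case one of the two happens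
> (`forall_pow_hodgeClassSpan_eq_or_exists_exceptional_pow`).

For `K/ℚ` Galois the smallest inducing subfield is `k_Φ = K^{Stab(Φ)}`, `[k_Φ:ℚ] = [K:ℚ]/|Stab(Φ)|`, and the
criterion is the tree's `2·|Stab(Φ)|·(Rank(Φ) − 1) = [K:ℚ]` (`CMTypeRankStabilizerBoundHazamaCriterion`).

* §1 `two_mul_cmTypeRank_sub_one_le_finrank_of_inducedCMType`, `isNondegenerate_iff_two_mul_cmTypeRank_sub_one_eq`.
* §2 `forall_pow_hodgeClassSpan_eq_iff_exists_isNondegenerate_inducedCMType`,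
  **`forall_pow_hodgeClassSpan_eq_iff_exists_two_mul_cmTypeRank_sub_one_eq`**,
  `exists_exceptional_pow_of_forall_inducedCMType_lt`, `forall_pow_hodgeClassSpan_eq_or_exists_exceptional_pow`,
  **`forall_pow_hodgeClassSpan_eq_iff_of_minimal`** (the primitive core).

HONEST SCOPE.  Assembly (Hazama's criterion, Lemma I.3.5, rank invariance are the tree's); exceptional classes are
located on SOME power only (on `A` itself the tree needs an abelian core field).  THEOREMS ONLY: no definition, no
named fact, no instance, no `sorry`.

## References

* [Gordon1999HodgeAVSurvey] B. B. Gordon, *A survey of the Hodge conjecture for abelian varieties*, Thm. 6.4, §9.2.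
* [Streng2010] M. Streng, *Complex multiplication of abelian surfaces*, PhD thesis, Leiden 2010, Ch. I Lemma 3.5.
* [Shimura1998] G. Shimura, *Abelian Varieties with Complex Multiplication and Modular Functions*, §8.2 Prop. 26, §32.9.
* [Hazama2003CyclicCM] F. Hazama, *Hodge cycles on abelian varieties with complex multiplication by cyclic CM-fields*,
  p. 582.
* [Kubota1965] T. Kubota, *On the field extension by complex multiplication*, Trans. AMS 118 (1965), §2.

## Provenance

Lane `lit-hodgefound` (Track 2, Layers A4/A5), seat `lit-hodgefound-p10` generation 39, row g39-#13; neighbours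
cited by name, nothing restated: `NonSimpleCMAbelianVarietyHazamaCriterion`
(`isNondegenerate_iff_forall_pow_hodgeClassSpan_eq_inducedCMType`, `exists_exceptional_pow_of_not_isNondegenerate_inducedCMType`,
`IsNondegenerate.hodgeClassSpan_pow_eq_divisorClassesSpan_inducedCMType`), `CMTypeInducedFromPrimitive`
(`exists_primitive_inducedCMType_eq_of_isCMField`), `CMTypeRankInducedType` (`cmTypeRank_inducedCMType`),
`NondegenerateCMTypeDivisorClasses` (`isNondegenerate_iff`, `cmTypeRank_le`), `CMTypeLattice` (`two_mul_card_eq_finrank`),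
`CMGaloisSubfield` (`isCMField_of_cmType_intermediateField`).
-/

open scoped BigOperators NumberField Classical
open NumberField Module CategoryTheory CategoryTheory.Limits IntermediateField

namespace Literature.AlgebraicGeometry.Pohlmann1968

open scoped Literature.NumberTheory.ComplexMultiplication
open Literature.NumberTheory.ComplexMultiplication (inducedCMType isCMField_of_cmType_intermediateField
  exists_primitive_inducedCMType_eq_of_isCMField)
open Literature.AlgebraicGeometry.Motives (CMType AbelianVariety)
open Literature.AlgebraicGeometry.HodgeTheory
open Literature.AlgebraicGeometry.VanGeemen1994 (hodgeClassSpan)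
open Literature.Barriers.HodgeConjecture (divisorClassesSpan)
open Literature.AlgebraicGeometry.ComplexMultiplication (IsCMTypeRealisation)

variable {K : Type} [Field K] [NumberField K] [IsCMField K]
  {A : AbelianVariety ℂ} {ι : 𝓞 K →+* End A} {θ : K →+* Module.End ℂ (complexBetti A.X 1)}

/-! ## §1 Rank versus the degree of an inducing subfield -/

section Degree

/-- The degree of a number field carrying a CM type is `2·#Ψ`. [folklore] -/
private theorem finrank_eq_two_mul_pc {L : Type} [Field L] [NumberField L] (Ψ : CMType L) :
    ∃ g : ℕ, finrank ℚ L = 2 * g :=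
  ⟨Fintype.card Ψ.1, (Literature.NumberTheory.ComplexMultiplication.CMTypeLattice.two_mul_card_eq_finrank Ψ).symm⟩

/-- **`2·(Rank(Φ) − 1) ≤ [k:ℚ]` for every CM subfield `k` from which `Φ` is induced** (`Rank(Ψ^K) = Rank(Ψ) ≤ [k:ℚ]/2 + 1`).
[cite: Shimura1998, §32.9] [cite: Kubota1965, §2] -/
theorem two_mul_cmTypeRank_sub_one_le_finrank_of_inducedCMType (k : IntermediateField ℚ K) (Ψ : CMType k)
    {Φ : CMType K} (hΨ : inducedCMType (algebraMap k K) Ψ = Φ) : 2 * (cmTypeRank Φ - 1) ≤ finrank ℚ k := by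
  haveI : IsCMField k := isCMField_of_cmType_intermediateField k Ψ
  have hr : cmTypeRank Φ = cmTypeRank Ψ := by rw [← cmTypeRank_inducedCMType (algebraMap k K) Ψ, hΨ]
  obtain ⟨g, hk⟩ := finrank_eq_two_mul_pc Ψ
  have hle : cmTypeRank Ψ ≤ finrank ℚ k / 2 + 1 := cmTypeRank_le Ψ
  rw [hk, Nat.mul_div_cancel_left _ two_pos] at hle
  rw [hr, hk]
  omega

omit [IsCMField K] in
/-- **`Ψ` nondegenerate ⟺ `[k:ℚ] = 2·(Rank(Φ) − 1)`** for `Φ = Ψ^K`. [cite: Shimura1998, §32.9] [cite: Kubota1965, §2] -/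
theorem isNondegenerate_iff_two_mul_cmTypeRank_sub_one_eq (k : IntermediateField ℚ K) (Ψ : CMType k)
    {Φ : CMType K} (hΨ : inducedCMType (algebraMap k K) Ψ = Φ) :
    IsNondegenerate Ψ ↔ 2 * (cmTypeRank Φ - 1) = finrank ℚ k := by
  have hr : cmTypeRank Φ = cmTypeRank Ψ := by rw [← cmTypeRank_inducedCMType (algebraMap k K) Ψ, hΨ]
  obtain ⟨g, hk⟩ := finrank_eq_two_mul_pc Ψ
  have hpos : 0 < finrank ℚ k := finrank_pos
  rw [isNondegenerate_iff, hr, hk, Nat.mul_div_cancel_left _ two_pos]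
  omega

end Degree

/-! ## §2 Hazama's criterion for an arbitrary CM field, by rank and core degree -/

section Hazama

/-- **Any CM field: `Bᵐ(Aⁿ) ⊗ ℂ = Dᵐ(Aⁿ) ⊗ ℂ` for all `n, m` ⟺ `Φ` is induced from a NONDEGENERATE type of some CM
subfield** (`⟹`: the primitive core, Hazama's criterion; `⟸`: Pohlmann–Hazama for induced types).
[cite: Gordon1999HodgeAVSurvey, Thm. 6.4] [cite: Streng2010, Ch. I Lemma 3.5] [cite: Shimura1998, §8.2 Prop. 26] -/
theorem forall_pow_hodgeClassSpan_eq_iff_exists_isNondegenerate_inducedCMType (Φ : CMType K)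
    (hA : IsCMTypeRealisation Φ A ι θ) :
    (∀ n m : ℕ, hodgeClassSpan (⨁ fun _ : Fin n => A).dim (⨁ fun _ : Fin n => A).X m =
        divisorClassesSpan (⨁ fun _ : Fin n => A).X (⨁ fun _ : Fin n => A).dim m) ↔
      ∃ (k : IntermediateField ℚ K) (Ψ : CMType k), inducedCMType (algebraMap k K) Ψ = Φ ∧ IsNondegenerate Ψ := by
  constructor
  · intro h
    obtain ⟨K₁, Φ₁, hK₁, hΦ, hsep, -⟩ := exists_primitive_inducedCMType_eq_of_isCMField Φ
    haveI := hK₁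
    exact ⟨K₁, Φ₁, hΦ, (isNondegenerate_iff_forall_pow_hodgeClassSpan_eq_inducedCMType hΦ hsep hA).2 h⟩
  · rintro ⟨k, Ψ, hΨ, hnd⟩ n m
    haveI : IsCMField k := isCMField_of_cmType_intermediateField k Ψ
    exact hnd.hodgeClassSpan_pow_eq_divisorClassesSpan_inducedCMType hΨ hA n m

/-- **ANY CM FIELD: `Bᵐ(Aⁿ) ⊗ ℂ = Dᵐ(Aⁿ) ⊗ ℂ` FOR ALL `n, m` ⟺ `Φ` IS INDUCED FROM A CM SUBFIELD `k` WITH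
`[k:ℚ] = 2·(Rank(Φ) − 1)`.** [cite: Gordon1999HodgeAVSurvey, Thm. 6.4] [cite: Shimura1998, §8.2 Prop. 26, §32.9]
[cite: Streng2010, Ch. I Lemma 3.5] -/
theorem forall_pow_hodgeClassSpan_eq_iff_exists_two_mul_cmTypeRank_sub_one_eq (Φ : CMType K)
    (hA : IsCMTypeRealisation Φ A ι θ) :
    (∀ n m : ℕ, hodgeClassSpan (⨁ fun _ : Fin n => A).dim (⨁ fun _ : Fin n => A).X m =
        divisorClassesSpan (⨁ fun _ : Fin n => A).X (⨁ fun _ : Fin n => A).dim m) ↔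
      ∃ (k : IntermediateField ℚ K) (Ψ : CMType k),
        inducedCMType (algebraMap k K) Ψ = Φ ∧ 2 * (cmTypeRank Φ - 1) = finrank ℚ k := by
  rw [forall_pow_hodgeClassSpan_eq_iff_exists_isNondegenerate_inducedCMType Φ hA]
  constructor
  · rintro ⟨k, Ψ, hΨ, hnd⟩
    exact ⟨k, Ψ, hΨ, (isNondegenerate_iff_two_mul_cmTypeRank_sub_one_eq k Ψ hΨ).1 hnd⟩
  · rintro ⟨k, Ψ, hΨ, heq⟩
    exact ⟨k, Ψ, hΨ, (isNondegenerate_iff_two_mul_cmTypeRank_sub_one_eq k Ψ hΨ).2 heq⟩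

/-- **Any CM field: if EVERY inducing CM subfield has `[k:ℚ] > 2·(Rank(Φ) − 1)`, some power of `A` carries an
exceptional Hodge class** (the primitive core is degenerate). [cite: Gordon1999HodgeAVSurvey, Thm. 6.4 and §9.2]
[cite: Hazama2003CyclicCM, p. 582] -/
theorem exists_exceptional_pow_of_forall_inducedCMType_lt (Φ : CMType K)
    (hlt : ∀ (k : IntermediateField ℚ K) (Ψ : CMType k), inducedCMType (algebraMap k K) Ψ = Φ →
      2 * (cmTypeRank Φ - 1) < finrank ℚ k)
    (hA : IsCMTypeRealisation Φ A ι θ) :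
    ∃ n m : ℕ, ∃ c : complexBetti (⨁ fun _ : Fin n => A).X (2 * m), IsRationalClass c ∧
      IsOfHodgeType (⨁ fun _ : Fin n => A).dim (⨁ fun _ : Fin n => A).X (2 * m) m m c ∧
      c ∉ divisorClassesSpan (⨁ fun _ : Fin n => A).X (⨁ fun _ : Fin n => A).dim m := by
  obtain ⟨K₁, Φ₁, hK₁, hΦ, hsep, -⟩ := exists_primitive_inducedCMType_eq_of_isCMField Φ
  haveI := hK₁
  have hdeg : ¬ IsNondegenerate Φ₁ := fun hnd =>
    absurd ((isNondegenerate_iff_two_mul_cmTypeRank_sub_one_eq K₁ Φ₁ hΦ).1 hnd) (hlt K₁ Φ₁ hΦ).ne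
  exact exists_exceptional_pow_of_not_isNondegenerate_inducedCMType hΦ hsep hdeg hA

/-- **THE DICHOTOMY FOR AN ARBITRARY CM FIELD**: either `Bᵐ(Aⁿ) ⊗ ℂ = Dᵐ(Aⁿ) ⊗ ℂ` for all `n, m`, or some power of
`A` carries an exceptional Hodge class. [cite: Gordon1999HodgeAVSurvey, Thm. 6.4, §9.2] [cite: Streng2010, Ch. I Lemma 3.5] -/
theorem forall_pow_hodgeClassSpan_eq_or_exists_exceptional_pow (Φ : CMType K) (hA : IsCMTypeRealisation Φ A ι θ) :
    (∀ n m : ℕ, hodgeClassSpan (⨁ fun _ : Fin n => A).dim (⨁ fun _ : Fin n => A).X m =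
        divisorClassesSpan (⨁ fun _ : Fin n => A).X (⨁ fun _ : Fin n => A).dim m) ∨
      ∃ n m : ℕ, ∃ c : complexBetti (⨁ fun _ : Fin n => A).X (2 * m), IsRationalClass c ∧
        IsOfHodgeType (⨁ fun _ : Fin n => A).dim (⨁ fun _ : Fin n => A).X (2 * m) m m c ∧
        c ∉ divisorClassesSpan (⨁ fun _ : Fin n => A).X (⨁ fun _ : Fin n => A).dim m := by
  obtain ⟨K₁, Φ₁, hK₁, hΦ, hsep, -⟩ := exists_primitive_inducedCMType_eq_of_isCMField Φ
  haveI := hK₁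
  by_cases hnd : IsNondegenerate Φ₁
  · exact Or.inl fun n m => hnd.hodgeClassSpan_pow_eq_divisorClassesSpan_inducedCMType hΦ hA n m
  · exact Or.inr (exists_exceptional_pow_of_not_isNondegenerate_inducedCMType hΦ hsep hnd hA)

/-- **THE PRIMITIVE CORE DECIDES**: for the smallest inducing sub-pair `(K₁, Φ₁)` (every inducing sub-pair contains
it; tree `exists_primitive_inducedCMType_eq_of_isCMField`), `Bᵐ(Aⁿ) ⊗ ℂ = Dᵐ(Aⁿ) ⊗ ℂ` for all `n, m` iff
**`[K₁:ℚ] = 2·(Rank(Φ) − 1)`**. [cite: Gordon1999HodgeAVSurvey, Thm. 6.4] [cite: Streng2010, Ch. I Lemma 3.5]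
[cite: Shimura1998, §8.2 Prop. 26, §32.9] -/
theorem forall_pow_hodgeClassSpan_eq_iff_of_minimal {Φ : CMType K} {K₁ : IntermediateField ℚ K} {Φ₁ : CMType K₁}
    (hΦ : inducedCMType (algebraMap K₁ K) Φ₁ = Φ)
    (hmin : ∀ (K₂ : IntermediateField ℚ K) (Φ₂ : CMType K₂), inducedCMType (algebraMap K₂ K) Φ₂ = Φ →
      ∃ h : K₁ ≤ K₂, inducedCMType (IntermediateField.inclusion h : K₁ →+* K₂) Φ₁ = Φ₂)
    (hA : IsCMTypeRealisation Φ A ι θ) :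
    (∀ n m : ℕ, hodgeClassSpan (⨁ fun _ : Fin n => A).dim (⨁ fun _ : Fin n => A).X m =
        divisorClassesSpan (⨁ fun _ : Fin n => A).X (⨁ fun _ : Fin n => A).dim m) ↔
      2 * (cmTypeRank Φ - 1) = finrank ℚ K₁ := by
  rw [forall_pow_hodgeClassSpan_eq_iff_exists_two_mul_cmTypeRank_sub_one_eq Φ hA]
  constructor
  · rintro ⟨k, Ψ, hΨ, heq⟩
    obtain ⟨hle, -⟩ := hmin k Ψ hΨ
    have h1 := two_mul_cmTypeRank_sub_one_le_finrank_of_inducedCMType K₁ Φ₁ hΦ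
    have h2 : finrank ℚ K₁ ≤ finrank ℚ k := IntermediateField.finrank_le_of_le_right hle
    omega
  · intro heq
    exact ⟨K₁, Φ₁, hΦ, heq⟩

/-- **Corollary: every CM type of every CM field has a primitive core, and the core decides** — there are a CM
subfield `K₁` and a type `Φ₁` of `K₁` inducing `Φ`, contained in every inducing sub-pair, with
`(∀ n m, Bᵐ(Aⁿ) ⊗ ℂ = Dᵐ(Aⁿ) ⊗ ℂ) ⟺ [K₁:ℚ] = 2·(Rank(Φ) − 1)` for every `A` of type `(K; Φ)`.
[cite: Streng2010, Ch. I Lemma 3.5] [cite: Gordon1999HodgeAVSurvey, Thm. 6.4] -/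
theorem exists_core_forall_pow_hodgeClassSpan_eq_iff (Φ : CMType K) :
    ∃ (K₁ : IntermediateField ℚ K) (Φ₁ : CMType K₁), inducedCMType (algebraMap K₁ K) Φ₁ = Φ ∧
      (∀ (K₂ : IntermediateField ℚ K) (Φ₂ : CMType K₂), inducedCMType (algebraMap K₂ K) Φ₂ = Φ → K₁ ≤ K₂) ∧
      ∀ (A : AbelianVariety ℂ) (ι : 𝓞 K →+* End A) (θ : K →+* Module.End ℂ (complexBetti A.X 1)),
        IsCMTypeRealisation Φ A ι θ →
          ((∀ n m : ℕ, hodgeClassSpan (⨁ fun _ : Fin n => A).dim (⨁ fun _ : Fin n => A).X m =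
              divisorClassesSpan (⨁ fun _ : Fin n => A).X (⨁ fun _ : Fin n => A).dim m) ↔
            2 * (cmTypeRank Φ - 1) = finrank ℚ K₁) := by
  obtain ⟨K₁, Φ₁, -, hΦ, -, hmin⟩ := exists_primitive_inducedCMType_eq_of_isCMField Φ
  exact ⟨K₁, Φ₁, hΦ, fun K₂ Φ₂ h₂ => (hmin K₂ Φ₂ h₂).1,
    fun A ι θ hA => forall_pow_hodgeClassSpan_eq_iff_of_minimal hΦ hmin hA⟩

end Hazama

end Literature.AlgebraicGeometry.Pohlmann1968
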